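import Summits.ResolutionOfSingularities.ResolutionOfSingularities.Theorems.PurelyInseparableDim4EquimultipleCover
import Literature.AlgebraicGeometry.Resolution.BlowupDisjointCentreSplitting
import HarnessLib

/-!
# Purely inseparable four-folds `z^p + F(x₁, …, x₄)`: CHART TRANSPOSITION — a rational point of the `x_{j′}`-chart
# of a blow-up of `𝔸⁵` along `V(z, x_S)` with `x_j`-coordinate `≠ 0` IS a rational point of the `x_j`-chart, with
# explicit coordinates (brick S3 (c) «joint point∘coordinate chains», part 17, cell `res-dim4-pi`)

[OURS · counted 0] (D-0157 DOOR 2; desk WORD #66 (4)(c), #74 (g), #99 (d); frame `PIDim4.TerminationImpliesOrderReduction`,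
S3 (c); host item stmt-ResolutionOfSingularities-16155, helper). Nothing here proves resolution of singularities in
dimension ≥ 4 / characteristic `p` — NOT here, not anywhere in this programme.

The «chart-to-chart transition of `AffineCoordBlowup`» that part 13 / typ-2 g3's GROUPING left open («the cross-chart case
`b′_j ≠ 0` … needs the chart-to-chart transition, not in the tree as a lemma»), at RATIONAL POINTS, for ANY blowing up
`π : W → 𝔸⁵_K` of `V(z, x_S)` (`IsBlowup`, universal property) and its affine-space charts `chartImm_m : 𝔸⁵_K → W`
(`AffineCoordinateBlowupCharts`): for `j ≠ j′` in `S` and a rational point `(a′, b′)` of the `x_{j′}`-chart ON THE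
EXCEPTIONAL DIVISOR (`b′_{j′} = 0`) with `b′_j ≠ 0`,

  `chartImm_{j′} (a′, b′) = chartImm_j (a′/b′_j, τb′)`, `(τb′)_j = 0`, `(τb′)_{j′} = 1/b′_j`,
  `(τb′)_i = b′_i/b′_j` (`i ∈ S ∖ {j, j′}`), `(τb′)_i = b′_i` (`i ∉ S`)

(**`chartImm_transpose`**). PROOF WITHOUT TRANSITION FUNCTIONS: the two LINES `t ↦ chartImm_{j′}(a′, b′ + t·e_{j′})` and
`t ↦ chartImm_j(a′/b′_j, τb′ + t b′_j·e_j)` (`𝔸¹_K → W`) have the same composite with `π` (an identity of substitutions,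
`lineSubst_comp_eq`), hence agree on `t ≠ 0`, where they run OFF the centre and `π` is an isomorphism
(`IsBlowup.isIso_morphismRestrict_compl_of_vanishingIdeal`, `hom_eq_of_comp_eq_of_isIso_morphismRestrict`); `π` is
separated (proper) and `{t ≠ 0}` is dense in the reduced `𝔸¹`, so the lines agree (Mathlib's
`ext_of_isDominant_of_isSeparated`), in particular at `t = 0`. §1 rational points under substitutions
(`specMap_aeval_apply_pt`); §2 the cancellation lemma; §3 the substitution identity; §4 the theorem.

USE (successor files): the monotone joint forest's COVER condition can be asked for NORMALISED chart representatives only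
(`b′_k = 0` for `k ∈ S`, `k < j′`), lifting part 14's per-chart restriction. AI-produced formalisation, weaker than expert
review. bears_on: LADDER-RESOLUTION:D157-DOOR2 (res-dim4-pi · S3 (c) joint · chart transposition).
-/

set_option linter.dupNamespace false -- D-0017: single-problem summit path `Summit.<S>.<S>.…` by design

noncomputable section

open MvPolynomial Finset CategoryTheory AlgebraicGeometry Opposite TopologicalSpace
open AlgebraicGeometry.Scheme.IdealSheafData (ofIdealTop vanishingIdeal)

namespace Summit.ResolutionOfSingularities.ResolutionOfSingularities.Theorems.PIDim4

open Literature.AlgebraicGeometry.Resolution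
open Literature.AlgebraicGeometry.Resolution.AffinePointBlowup (P A γ coord Wtop ξ)

namespace ChartDictionary

/-! ## §1 Rational points under substitutions -/

section Points

variable {K : Type} [Field K]

/-- **`Spec` of a substitution on rational points**: the substitution `X m ↦ g m` (`g m ∈ K[t₀, …, t_e]`) sends the
rational point `w` of `Spec K[t]` to the rational point `(g m (w))_m` of `Spec K[X]`. [folklore] -/
theorem specMap_aeval_apply_pt {n e : ℕ} (g : Fin (n + 1) → A e K) (w : Fin (e + 1) → K) (y : P e K)
    (hy : y.asIdeal = MvPolynomial.vanishingIdeal K {w}) :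
    ((Spec.map (CommRingCat.ofHom (aeval g : A n K →ₐ[K] A e K).toRingHom)) y).asIdeal =
      MvPolynomial.vanishingIdeal K {(fun m => aeval w (g m) : Fin (n + 1) → K)} := by
  ext f
  rw [Spec.map_apply, PrimeSpectrum.comap_asIdeal, Ideal.mem_comap, CommRingCat.hom_ofHom, hy,
    MvPolynomial.mem_vanishingIdeal_singleton_iff, MvPolynomial.mem_vanishingIdeal_singleton_iff]
  change aeval w (bind₁ g f) = 0 ↔ _
  rw [MvPolynomial.aeval_bind₁ w g f]

/-- Points of the basic open `D(t₀) ⊆ 𝔸ᵉ⁺¹_K`: those primes not containing `t₀`. [folklore] -/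
theorem mem_basicOpen_γ_symm_X_iff {e : ℕ} (i : Fin (e + 1)) (y : P e K) :
    y ∈ (P e K).basicOpen ((γ e K).symm (X i)) ↔ (X i : A e K) ∉ y.asIdeal := by
  rw [AffinePointBlowup.γ_symm_apply (n := e) (K := K) (X i), basicOpen_eq_of_affine]
  exact PrimeSpectrum.mem_basicOpen _ y

end Points

/-! ## §2 Cancellation over the open where the blow-up is an isomorphism -/

section Cancel

universe u

/-- **Two morphisms into `W` with the same composite with `π : W → X` agree if that composite lands in an open `V ⊆ X`
over which `π` restricts to an isomorphism** (lift both through `π⁻¹(V) ↪ W` and cancel `π|_V` and `V ↪ X`).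
[cite: GortzWedhorn2020, Prop. 13.91 (3)] -/
theorem hom_eq_of_comp_eq_of_isIso_morphismRestrict {D W X : Scheme.{u}} {π : W ⟶ X} (V : X.Opens)
    [IsIso (π ∣_ V)] {u₁ u₂ : D ⟶ W} (h : u₁ ≫ π = u₂ ≫ π) (hV : ∀ d : D, π (u₁ d) ∈ V) : u₁ = u₂ := by
  have hr₁ : Set.range u₁ ⊆ Set.range (π ⁻¹ᵁ V).ι := by
    rw [Scheme.Opens.range_ι]
    rintro _ ⟨d, rfl⟩
    exact hV d
  have hr₂ : Set.range u₂ ⊆ Set.range (π ⁻¹ᵁ V).ι := by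
    rw [Scheme.Opens.range_ι]
    rintro _ ⟨d, rfl⟩
    show π (u₂ d) ∈ V
    rw [← Scheme.Hom.comp_apply, ← h, Scheme.Hom.comp_apply]
    exact hV d
  have hv₁ := IsOpenImmersion.lift_fac (π ⁻¹ᵁ V).ι u₁ hr₁
  have hv₂ := IsOpenImmersion.lift_fac (π ⁻¹ᵁ V).ι u₂ hr₂
  have key : IsOpenImmersion.lift (π ⁻¹ᵁ V).ι u₁ hr₁ ≫ (π ∣_ V) =
      IsOpenImmersion.lift (π ⁻¹ᵁ V).ι u₂ hr₂ ≫ (π ∣_ V) := by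
    rw [← cancel_mono V.ι, Category.assoc, Category.assoc, morphismRestrict_ι, ← Category.assoc, ← Category.assoc,
      hv₁, hv₂, h]
  rw [cancel_mono] at key
  rw [← hv₁, ← hv₂, key]

end Cancel

/-! ## §3 The substitution identity behind the two lines -/

section Subst

variable {K : Type} [Field K] {S : Finset (Fin 4)} {j j' : Fin 4}

/-- `xᵢ` is NOT a coordinate of the centre `V(z, x_S)` when `i ∉ S`. -/
theorem succ_not_mem_centreVars {i : Fin 4} (hi : i ∉ S) :
    i.succ ∉ (insert 0 (Fin.succ '' (S : Set (Fin 4))) : Set (Fin (4 + 1))) := fun h =>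
  hi ((succ_mem_centreVars_iff S i).mp h)

/-- **The two lines have the same shadow in `𝔸⁵`**: with `c′ = (a′, b′)`, `c = (a′/b′_j, τb′)` (`b′_{j′} = 0`, `b′_j ≠ 0`),
the substitutions `σ_{j′} ∘ [X_{j′+1} ↦ t, X_m ↦ c′_m]` and `σ_j ∘ [X_{j+1} ↦ b′_j t, X_m ↦ c_m]` of `K[z, x] → K[t]`
coincide (`σ_m` the chart substitution `coordBlowupSubst`). [cite: Hu2025, §5 Prop. 5.3] -/
theorem lineSubst_comp_eq (hj : j ∈ S) (hj' : j' ∈ S) (hjj' : j ≠ j') (a' : K) (b' : Fin 4 → K)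
    (hbj' : b' j' = 0) (hb : b' j ≠ 0) :
    (aeval (fun m : Fin (4 + 1) => if m = j'.succ then (X 0 : A 0 K) else
        C ((Fin.cons a' b' : Fin (4 + 1) → K) m)) : A 4 K →ₐ[K] A 0 K).comp
      (coordBlowupSubst K (insert 0 (Fin.succ '' (S : Set (Fin 4)))) j'.succ) =
    (aeval (fun m : Fin (4 + 1) => if m = j.succ then C (b' j) * (X 0 : A 0 K) else
        C ((Fin.cons (a' * (b' j)⁻¹)
          (fun i => if i = j then 0 else if i = j' then (b' j)⁻¹ else if i ∈ S then b' i * (b' j)⁻¹ else b' i) :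
            Fin (4 + 1) → K) m)) : A 4 K →ₐ[K] A 0 K).comp
      (coordBlowupSubst K (insert 0 (Fin.succ '' (S : Set (Fin 4)))) j.succ) := by
  have hΛj := succ_mem_centreVars hj
  have hΛj' := succ_mem_centreVars hj'
  have hss : j.succ ≠ j'.succ := fun h => hjj' (Fin.succ_inj.mp h)
  have hbb : b' j * (b' j)⁻¹ = 1 := mul_inv_cancel₀ hb
  have hC : (C (b' j) : A 0 K) * C ((b' j)⁻¹) = 1 := by rw [← map_mul, hbb, map_one]
  refine MvPolynomial.algHom_ext fun m => ?_
  rw [AlgHom.comp_apply, AlgHom.comp_apply]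
  rcases Fin.eq_zero_or_eq_succ m with rfl | ⟨i, rfl⟩
  · -- `z ↦ x_{j′} z`, resp. `x_j z`
    rw [coordBlowupSubst_X_of_mem_of_ne K _ j'.succ (zero_mem_centreVars S) (Fin.succ_ne_zero j').symm,
      coordBlowupSubst_X_of_mem_of_ne K _ j.succ (zero_mem_centreVars S) (Fin.succ_ne_zero j).symm,
      map_mul, map_mul, aeval_X, aeval_X, aeval_X, aeval_X, if_pos rfl, if_neg (Fin.succ_ne_zero j').symm,
      if_pos rfl, if_neg (Fin.succ_ne_zero j).symm, Fin.cons_zero, Fin.cons_zero]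
    simp only [map_mul]
    linear_combination (-(X 0 * C a' : A 0 K)) * hC
  · by_cases hij' : i = j'
    · subst hij'
      rw [coordBlowupSubst_X_self, coordBlowupSubst_X_of_mem_of_ne K _ j.succ hΛj' hss.symm, map_mul, aeval_X,
        aeval_X, aeval_X, if_pos rfl, if_pos rfl, if_neg hss.symm, Fin.cons_succ, if_neg (Ne.symm hjj'), if_pos rfl,
        mul_assoc, mul_comm (X 0) (C _), ← mul_assoc, ← map_mul, hbb, map_one, one_mul]
    · by_cases hij : i = j
      · subst hij
        rw [coordBlowupSubst_X_self, coordBlowupSubst_X_of_mem_of_ne K _ j'.succ hΛj hss, map_mul, aeval_X,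
          aeval_X, aeval_X, if_pos rfl, if_neg hss, if_pos rfl, Fin.cons_succ, mul_comm]
      · have hss_i : i.succ ≠ j.succ := fun h => hij (Fin.succ_inj.mp h)
        have hss_i' : i.succ ≠ j'.succ := fun h => hij' (Fin.succ_inj.mp h)
        by_cases hiS : i ∈ S
        · rw [coordBlowupSubst_X_of_mem_of_ne K _ j'.succ (succ_mem_centreVars hiS) hss_i',
            coordBlowupSubst_X_of_mem_of_ne K _ j.succ (succ_mem_centreVars hiS) hss_i, map_mul, map_mul,
            aeval_X, aeval_X, aeval_X, aeval_X, if_pos rfl, if_neg hss_i', if_pos rfl, if_neg hss_i,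
            Fin.cons_succ, Fin.cons_succ, if_neg hij, if_neg hij', if_pos hiS]
          simp only [map_mul]
          linear_combination (-(C (b' i) * X 0 : A 0 K)) * hC
        · rw [coordBlowupSubst_X_of_not_mem K _ j'.succ (succ_not_mem_centreVars hiS),
            coordBlowupSubst_X_of_not_mem K _ j.succ (succ_not_mem_centreVars hiS), aeval_X, aeval_X,
            if_neg hss_i', if_neg hss_i, Fin.cons_succ, Fin.cons_succ, if_neg hij, if_neg hij', if_neg hiS]

end Subst

/-! ## §4 The transposition -/

section Transpose

variable {K : Type} [Field K] {S : Finset (Fin 4)} {j j' : Fin 4} {Bl : Scheme.{0}} {B : Bl ⟶ P 4 K}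

/-- **CHART TRANSPOSITION AT A RATIONAL POINT OF THE EXCEPTIONAL DIVISOR.** `π : W → 𝔸⁵_K` any blowing up of
`V(z, x_S)`, `j ≠ j′` in `S`, `(a′, b′)` with `b′_{j′} = 0`, `b′_j ≠ 0`: the point `(a′, b′)` of the `x_{j′}`-chart is the
point `(a′/b′_j, τb′)` of the `x_j`-chart. See the module docstring for the proof.
[cite: GortzWedhorn2020, Prop. 13.91 (3) (π is an isomorphism off the centre); Def. 9.7 ff. (separatedness)]
[cite: Hu2025, §5 Prop. 5.3 (the chart substitutions)] -/
theorem chartImm_transpose (hB : IsBlowup B (AffineCoordBlowup.𝓘Λ 4 K (insert 0 (Fin.succ '' (S : Set (Fin 4))))))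
    (hj : j ∈ S) (hj' : j' ∈ S) (hjj' : j ≠ j') (a' : K) (b' : Fin 4 → K) (hbj' : b' j' = 0) (hb : b' j ≠ 0)
    {x' x : P 4 K} (hx' : x'.asIdeal = MvPolynomial.vanishingIdeal K {(Fin.cons a' b' : Fin (4 + 1) → K)})
    (hx : x.asIdeal = MvPolynomial.vanishingIdeal K {(Fin.cons (a' * (b' j)⁻¹)
      (fun i => if i = j then 0 else if i = j' then (b' j)⁻¹ else if i ∈ S then b' i * (b' j)⁻¹ else b' i) :
        Fin (4 + 1) → K)}) :
    AffineCoordBlowup.chartImm hB (succ_mem_centreVars hj') x' =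
      AffineCoordBlowup.chartImm hB (succ_mem_centreVars hj) x := by
  classical
  haveI : IsProper B := hB.isProper
  set Λ : Set (Fin (4 + 1)) := insert 0 (Fin.succ '' (S : Set (Fin 4))) with hΛ
  set c' : Fin (4 + 1) → K := Fin.cons a' b' with hc'
  set c : Fin (4 + 1) → K := Fin.cons (a' * (b' j)⁻¹)
    (fun i => if i = j then 0 else if i = j' then (b' j)⁻¹ else if i ∈ S then b' i * (b' j)⁻¹ else b' i) with hc
  -- the two lines `𝔸¹ → 𝔸⁵ → W`
  set g₁ : Fin (4 + 1) → A 0 K := fun m => if m = j'.succ then X 0 else C (c' m) with hg₁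
  set g₂ : Fin (4 + 1) → A 0 K := fun m => if m = j.succ then C (b' j) * X 0 else C (c m) with hg₂
  set L₁ : A 4 K →ₐ[K] A 0 K := aeval g₁ with hL₁
  set L₂ : A 4 K →ₐ[K] A 0 K := aeval g₂ with hL₂
  set f : P 0 K ⟶ Bl := Spec.map (CommRingCat.ofHom L₁.toRingHom) ≫
    AffineCoordBlowup.chartImm hB (succ_mem_centreVars hj') with hf
  set g : P 0 K ⟶ Bl := Spec.map (CommRingCat.ofHom L₂.toRingHom) ≫
    AffineCoordBlowup.chartImm hB (succ_mem_centreVars hj) with hg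
  -- same composite with `π`
  have hM : L₁.comp (coordBlowupSubst K Λ j'.succ) = L₂.comp (coordBlowupSubst K Λ j.succ) :=
    lineSubst_comp_eq hj hj' hjj' a' b' hbj' hb
  have hfB : f ≫ B = Spec.map (CommRingCat.ofHom (L₁.comp (coordBlowupSubst K Λ j'.succ)).toRingHom) := by
    rw [hf, Category.assoc, AffineCoordBlowup.chartImm_comp, ← Spec.map_comp, ← CommRingCat.ofHom_comp]
    rfl
  have hgB : g ≫ B = Spec.map (CommRingCat.ofHom (L₂.comp (coordBlowupSubst K Λ j.succ)).toRingHom) := by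
    rw [hg, Category.assoc, AffineCoordBlowup.chartImm_comp, ← Spec.map_comp, ← CommRingCat.ofHom_comp]
    rfl
  have hfg : f ≫ B = g ≫ B := by rw [hfB, hgB, hM]
  -- the dense open `t ≠ 0` of the reduced `𝔸¹`
  set U : (P 0 K).Opens := (P 0 K).basicOpen ((γ 0 K).symm (X 0)) with hU
  haveI : IrreducibleSpace (P 0 K) := inferInstanceAs (IrreducibleSpace (PrimeSpectrum (A 0 K)))
  have hUne : ((U : (P 0 K).Opens) : Set (P 0 K)).Nonempty := by
    refine ⟨⟨MvPolynomial.vanishingIdeal K {(fun _ => 1 : Fin (0 + 1) → K)}, inferInstance⟩, ?_⟩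
    rw [SetLike.mem_coe, hU, mem_basicOpen_γ_symm_X_iff, MvPolynomial.mem_vanishingIdeal_singleton_iff, aeval_X]
    exact one_ne_zero
  haveI : IsDominant U.ι := AlgebraicGeometry.Opens.isDominant_ι (U.2.dense hUne)
  -- on `t ≠ 0` the lines run off the centre, where `π` is an isomorphism
  haveI : IsIso (B ∣_ (AffineCoordBlowup.CΛ 4 K Λ).compl) := hB.isIso_morphismRestrict_compl_of_vanishingIdeal
  have hUfg : U.ι ≫ f = U.ι ≫ g := by
    have hfgU : (U.ι ≫ f) ≫ B = (U.ι ≫ g) ≫ B := by rw [Category.assoc, hfg, ← Category.assoc]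
    refine hom_eq_of_comp_eq_of_isIso_morphismRestrict (π := B) (AffineCoordBlowup.CΛ 4 K Λ).compl hfgU fun y => ?_
    have hy : (X 0 : A 0 K) ∉ (U.ι y).asIdeal := by
      rw [← mem_basicOpen_γ_symm_X_iff]
      exact (Scheme.Opens.range_ι U).le ⟨y, rfl⟩
    change ¬ (B ((U.ι ≫ f) y) ∈ (AffineCoordBlowup.CΛ 4 K Λ : Set (P 4 K)))
    rw [show B ((U.ι ≫ f) y) = (f ≫ B) (U.ι y) from rfl, hfB, SetLike.mem_coe, AffineCoordBlowup.mem_CΛ_iff']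
    intro hall
    have h1 := hall j'.succ (succ_mem_centreVars hj')
    rw [Spec.map_apply, PrimeSpectrum.comap_asIdeal, Ideal.mem_comap, CommRingCat.hom_ofHom] at h1
    change L₁ (coordBlowupSubst K Λ j'.succ (X j'.succ)) ∈ (U.ι y).asIdeal at h1
    rw [coordBlowupSubst_X_self, hL₁, aeval_X, hg₁] at h1
    simp only [if_true] at h1
    exact hy h1
  -- separatedness: the lines agree
  have hfg' : f = g := ext_of_isDominant_of_isSeparated B hfg U.ι hUfg
  -- evaluate at `t = 0`
  let t0 : P 0 K := ⟨MvPolynomial.vanishingIdeal K {(0 : Fin (0 + 1) → K)}, inferInstance⟩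
  have h01 : aeval (0 : Fin (0 + 1) → K) (X 0 : A 0 K) = 0 := by rw [aeval_X]; rfl
  have h1 : (Spec.map (CommRingCat.ofHom L₁.toRingHom)) t0 = x' := by
    apply PrimeSpectrum.ext
    rw [hL₁, specMap_aeval_apply_pt g₁ 0 t0 rfl, hx']
    congr 2
    funext m
    rw [hg₁]
    by_cases hm : m = j'.succ
    · simp only [hm, if_true, h01, hc', Fin.cons_succ, hbj']
    · simp only [hm, if_false, aeval_C, hc']
      rfl
  have h2 : (Spec.map (CommRingCat.ofHom L₂.toRingHom)) t0 = x := by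
    apply PrimeSpectrum.ext
    rw [hL₂, specMap_aeval_apply_pt g₂ 0 t0 rfl, hx]
    congr 2
    funext m
    rw [hg₂]
    by_cases hm : m = j.succ
    · simp only [hm, if_true, map_mul, aeval_C, h01, mul_zero, hc, Fin.cons_succ]
    · simp only [hm, if_false, aeval_C, hc]
      rfl
  calc AffineCoordBlowup.chartImm hB (succ_mem_centreVars hj') x'
      = f t0 := by rw [hf, Scheme.Hom.comp_apply, h1]
    _ = g t0 := by rw [hfg']
    _ = AffineCoordBlowup.chartImm hB (succ_mem_centreVars hj) x := by rw [hg, Scheme.Hom.comp_apply, h2]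

end Transpose

end ChartDictionary

end Summit.ResolutionOfSingularities.ResolutionOfSingularities.Theorems.PIDim4

end
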